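import Literature.RepresentationTheory.HeisenbergGroup.MetaplecticSumStrippingRight
import Literature.RepresentationTheory.HeisenbergGroup.ImplementerTransport
import Literature.RepresentationTheory.HeisenbergGroup.DoubledDeltaDoublingIdentity
import Literature.NumberTheory.Automorphic.LocalPiSchwartzBruhatFourier
import HarnessLib

/-!
# The partial Fourier transform `𝓕_{x'} ⊠ 1` implements a partial Weyl element in the Schrödinger model of ANY Gram duality
# (IV-4(c1) piece P5(c) of the Hodge/COR-CM cell)

Topic `RepresentationTheory/HeisenbergGroup`; namespace `Literature.RepresentationTheory.HeisenbergGroup`.  KERNEL mathematics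
(two definitions with bodies + theorems; no named fact, no `sorry`).

Setting: `K` a non-archimedean local field with `2` invertible, a Gram matrix `A : Matrix ι ι K` with `det A` a unit, the
Schrödinger model `ρ_A = schrodingerSB (Matrix.toLinearMap₂' K A) ψ` of the Heisenberg group of `𝕎 = K^ι × K^ι`,
`β_A(x, y) = x ⬝ᵥ A y`, on `𝒮(K^ι)` ([MoeglinVignerasWaldspurger1987, Chap. 2 I.4 Exemple (1), II.6]; the tree's local models
`localSchrodinger F N T v` are literally of this form with `A = localGram F N T v`), and a splitting of the coordinates
`e : ι₁ ⊕ ι₂ ≃ ι` (`LocalSchwartzBruhatDirectSum`: `glue/resL/resR/boxSB/sumEndSB`; `𝒮(K^ι) = 𝒮(K^{ι₁}) ⊗ 𝒮(K^{ι₂})`).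

* §1 `dualCoords A hA : 𝕎 ≃ₗ 𝕎`, `(x, y) ↦ (x, A y)` — an isomorphism of Heisenberg data from `(𝕎, polar β_A)` to the STANDARD
  duality `(𝕎, polar β_1)` (`β_1(x, y) = x ⬝ᵥ y`); `ρ_A = ρ_1 ∘ mapEquiv (dualCoords)` (`schrodingerSB_gram_eq_mapEquiv`).
* §2 `partialWeyl A hA e : Sp(𝕎, polar β_A)` — THE PARTIAL WEYL ELEMENT OF THE `ι₁`-BLOCK READ IN `A`-DUAL COORDINATES:
  with `η := A y`, `(x' ⊔ x'', η' ⊔ η'') ↦ (η' ⊔ x'', (−x') ⊔ η'')` (`coe_partialWeyl_apply`); it is the conjugate by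
  `dualCoords` of `w₁ ⊕ 1`, `w₁ = weylSp (x', y') ↦ (y', −x')` of the `ι₁`-block (`SchrodingerSymplecticGenerators.weylSp`,
  `SchrodingerDirectSum.spInl`).  NO orthogonality of the coordinate blocks for `A` is needed: the dual coordinates absorb `A`.
* §3 **`implements_partialWeyl_boxFourier`** — the operator `𝓕_{x'} ⊠ 1 = boxEquivSB K e (piFourierEquivSB μ₁ hψ hm) 1`
  (Fourier transform of `𝒮(K^{ι₁})` for `ψ` and a Haar measure `μ₁`, tensored with the identity of `𝒮(K^{ι₂})`) IMPLEMENTS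
  `ofSymplectic (partialWeyl A hA e)` for `ρ_A`, i.e. `(partialWeyl, 𝓕_{x'} ⊠ 1) ∈ S̃p_ψ(𝕎)`
  [MoeglinVignerasWaldspurger1987, Chap. 2 II.1 (A), II.6; Weil1964 n° 13].  Proof: Weil's relation for the full Weyl element
  of `K^{ι₁}` (`piWeylPair_mem_mpPairs`, `ofSymplectic_weylSp`), moved from `dotProductBilin` to `toLinearMap₂' 1`
  (`implements_iff_implements_symplecticConj` along `refl`), tensored with `(1, 1)` on the `ι₂`-block (`implements_of_boxSB`),
  and transported from `A = 1` to `A` along `dualCoords` (`implements_iff_implements_symplecticConj`).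
* §4 bookkeeping for the consumers: `coe_boxEquivSB_eq_sumEndSB` (`boxEquivSB` vs `sumEndSB`, the currency of the
  quadric-support lemmas `SchwartzBruhatQuadric*`), and the conjugate of a LOWER Siegel unipotent supported on the `ι₁`-block
  by `partialWeyl` = the UPPER unipotent `(x, y) ↦ (x − (N₁ η') ⊔ 0, y)` (`coe_partialWeyl_conj_unipotentSp_apply`).

Use (cell hodgecm-mathlib, row IV-4(c1) `rankOne_theta_lines_disjoint`, KEY `b4-rank-one-theta-lines-disjoint`, pieces P4/P5/P7):
`A = localGram F (3+3) (gramD F 3 T) v` (the doubled local model), `e` = the polarisation mover's `4 + 2` splitting; the functional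
`D = Λ ∘ M₀⁻¹` transformed by `𝓕_{x'} ⊠ 1` is then eigen under the conjugated opposite root subgroup (two-unipotent route), and the
two-quadric uncertainty lemma `eq_zero_of_quadric_eigen_of_partialFourier_quadric_eigen` applies.  Nothing about theta lifts is
asserted here; HC_CM is proved only modulo the printed citations until rung 0 closes.

## References
* [MoeglinVignerasWaldspurger1987] C. Mœglin, M.-F. Vignéras, J.-L. Waldspurger, LNM 1291 (1987), Chap. 2 I.4, II.1 (A), II.6.
* [Weil1964] A. Weil, *Sur certains groupes d'opérateurs unitaires*, Acta Math. 111 (1964), n° 5–6, n° 13.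
* [Kudla1984] S. Kudla, *Seesaw dual reductive pairs*, Progr. Math. 46 (1984), §1 (`g₁ ⊕ 1`).
-/

set_option autoImplicit false

noncomputable section

open MeasureTheory
open scoped Matrix
open Literature.NumberTheory.Automorphic
open Literature.NumberTheory.GaloisRepresentations.IsNonarchimedeanLocalField

namespace Literature.RepresentationTheory.HeisenbergGroup

/-! ## §1 Dual coordinates `(x, y) ↦ (x, A y)` -/

section Dual

variable {K : Type*} [Field K] {ι : Type*} [Fintype ι] [DecidableEq ι] (A : Matrix ι ι K) (hA : IsUnit A.det)

/-- **dual coordinates** `(x, y) ↦ (x, A y)` on `𝕎 = K^ι × K^ι` (inverse `(x, η) ↦ (x, A⁻¹ η)`): an isomorphism of the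
Heisenberg data `(𝕎, polar β_A) ≅ (𝕎, polar β_1)`, `β_A(x,y) = x ⬝ A y`. [cite: Weil1964, n° 5, p. 150] -/
def dualCoords : ((ι → K) × (ι → K)) ≃ₗ[K] ((ι → K) × (ι → K)) where
  toFun w := (w.1, A *ᵥ w.2)
  invFun w := (w.1, A⁻¹ *ᵥ w.2)
  map_add' w w' := by simp only [Prod.fst_add, Prod.snd_add, Matrix.mulVec_add, Prod.mk_add_mk]
  map_smul' c w := by simp only [Prod.smul_fst, Prod.smul_snd, Matrix.mulVec_smul, RingHom.id_apply, Prod.smul_mk]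
  left_inv w := by
    simp only [Matrix.mulVec_mulVec, Matrix.nonsing_inv_mul A hA, Matrix.one_mulVec]
  right_inv w := by
    simp only [Matrix.mulVec_mulVec, Matrix.mul_nonsing_inv A hA, Matrix.one_mulVec]

/-- formula. [cite: Weil1964, n° 5, p. 150] -/
@[simp] theorem dualCoords_apply (w : (ι → K) × (ι → K)) : dualCoords A hA w = (w.1, A *ᵥ w.2) := rfl

/-- formula for the inverse. [cite: Weil1964, n° 5, p. 150] -/
@[simp] theorem dualCoords_symm_apply (w : (ι → K) × (ι → K)) : (dualCoords A hA).symm w = (w.1, A⁻¹ *ᵥ w.2) := rfl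

/-- `dualCoords` carries `polar β_A` to the standard `polar β_1`: `β_1(x, A y') = β_A(x, y')`. [cite: Weil1964, n° 5, p. 150] -/
theorem polar_one_dualCoords (v w : (ι → K) × (ι → K)) :
    polar (Matrix.toLinearMap₂' K (1 : Matrix ι ι K)) (dualCoords A hA v) (dualCoords A hA w) =
      polar (Matrix.toLinearMap₂' K A) v w := by
  simp only [polar_apply, dualCoords_apply, Matrix.toLinearMap₂'_apply', Matrix.one_mulVec]

end Dual

/-! ## §2 The partial Weyl element of the `ι₁`-block in `A`-dual coordinates -/

section PartialWeyl

variable {K : Type*} [Field K] [Invertible (2 : K)] {ι₁ ι₂ ι : Type*} [Fintype ι₁] [Fintype ι₂] [Fintype ι]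
  [DecidableEq ι₁] [DecidableEq ι₂] [DecidableEq ι] (A : Matrix ι ι K) (hA : IsUnit A.det) (e : ι₁ ⊕ ι₂ ≃ ι)

omit [Invertible (2 : K)] [Fintype ι₁] [Fintype ι₂] [Fintype ι] in
/-- `1 = 1 ⊕ 1` through any splitting of the coordinates (the `hT` of `SchrodingerDirectSum` for the standard duality).
[cite: Kudla1984, §1] -/
theorem one_eq_reindex_fromBlocks_one :
    (1 : Matrix ι ι K) = Matrix.reindex e e (Matrix.fromBlocks (1 : Matrix ι₁ ι₁ K) 0 0 (1 : Matrix ι₂ ι₂ K)) := by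
  rw [Matrix.fromBlocks_one, Matrix.reindex_apply, Matrix.submatrix_one_equiv]

omit [Invertible (2 : K)] in
/-- the self-duality relation for the standard pairing of the `ι₁`-block: `β_1(γ y, δ x) = -β_1(x, y)` with `γ = id`, `δ = -id`.
[cite: Weil1964, n° 6, p. 151] -/
theorem toLinearMap₂'_one_refl_neg (x y : ι₁ → K) :
    Matrix.toLinearMap₂' K (1 : Matrix ι₁ ι₁ K) (LinearEquiv.refl K (ι₁ → K) y) (LinearEquiv.neg K x) =
      -Matrix.toLinearMap₂' K (1 : Matrix ι₁ ι₁ K) x y := by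
  simp only [LinearEquiv.refl_apply, LinearEquiv.neg_apply, Matrix.toLinearMap₂'_apply', Matrix.one_mulVec,
    dotProduct_neg, dotProduct_comm y x]

/-- the Weyl element `(x', y') ↦ (y', -x')` of the `ι₁`-block for the standard duality. [cite: Weil1964, n° 6, p. 151] -/
abbrev weylSpOne (ι₁ : Type*) [Fintype ι₁] [DecidableEq ι₁] :
    symplecticGroup (polar (Matrix.toLinearMap₂' K (1 : Matrix ι₁ ι₁ K))) :=
  weylSp (Matrix.toLinearMap₂' K (1 : Matrix ι₁ ι₁ K)) (LinearEquiv.refl K (ι₁ → K)) (LinearEquiv.neg K)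
    toLinearMap₂'_one_refl_neg

/-- **the partial Weyl element of the `ι₁`-block in `A`-dual coordinates**: the conjugate by `dualCoords A` of `w₁ ⊕ 1`
(`w₁ = (x', y') ↦ (y', -x')` on the `ι₁`-block, identity on the `ι₂`-block), an element of `Sp(𝕎, polar β_A)`.
[cite: Weil1964, n° 6, p. 151] [cite: Kudla1984, §1] -/
def partialWeyl : symplecticGroup (polar (Matrix.toLinearMap₂' K A)) :=
  (symplecticConj (dualCoords A hA) (polar_one_dualCoords A hA)).symm
    (spInl e (1 : Matrix ι₁ ι₁ K) (1 : Matrix ι₂ ι₂ K) (one_eq_reindex_fromBlocks_one e) (weylSpOne (K := K) ι₁))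

omit [Invertible (2 : K)] in
/-- **formula**: with `η := A y`, `partialWeyl (x, y) = (η|₁ ⊔ x|₂, A⁻¹ ((−x|₁) ⊔ η|₂))`. [cite: Weil1964, n° 6, p. 151] -/
theorem coe_partialWeyl_apply (w : (ι → K) × (ι → K)) :
    ((partialWeyl A hA e : symplecticGroup (polar (Matrix.toLinearMap₂' K A))) :
        ((ι → K) × (ι → K)) ≃ₗ[K] ((ι → K) × (ι → K))) w =
      (glue e (resL e (A *ᵥ w.2)) (resR e w.1), A⁻¹ *ᵥ glue e (-(resL e w.1)) (resR e (A *ᵥ w.2))) := by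
  rw [partialWeyl, symplecticConj_symm_apply, coe_spInl, inlW_apply, dualCoords_apply, dualCoords_symm_apply]
  simp only [coe_weylSp, weylσ_apply, LinearEquiv.refl_apply, LinearEquiv.neg_apply]

end PartialWeyl

/-! ## §3 `𝓕_{x'} ⊠ 1` implements the partial Weyl element -/

section Implements

variable {K : Type*} [Field K] [ValuativeRel K] [TopologicalSpace K] [IsNonarchimedeanLocalField K]
  [Invertible (2 : K)] {ι₁ ι₂ ι : Type*} [Fintype ι₁] [Fintype ι₂] [Fintype ι]
  [DecidableEq ι₁] [DecidableEq ι₂] [DecidableEq ι] (A : Matrix ι ι K) (hA : IsUnit A.det) (e : ι₁ ⊕ ι₂ ≃ ι)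
  {ψ : AddChar K Circle} (hψ : ψ.IsContinuousNontrivial) {m : ℤ} (hm : ψ.HasConductorExp m)
  (hl : IsLocallyConstant (⇑ψ : K → Circle))
  (hb : ∀ y : ι → K, Continuous fun u : ι → K => Matrix.toLinearMap₂' K A u y)
  [MeasurableSpace (ι₁ → K)] [BorelSpace (ι₁ → K)] (μ₁ : Measure (ι₁ → K)) [μ₁.IsAddHaarMeasure]

omit [ValuativeRel K] [IsNonarchimedeanLocalField K] [Invertible (2 : K)] [Fintype ι₁] [DecidableEq ι₁] in
/-- `u ↦ β_T(u, y)` is continuous for every Gram matrix `T`. [cite: WeilBNT1967, Chap. II §1, Prop. 1] -/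
theorem continuous_toLinearMap₂'_left' {κ : Type*} [Fintype κ] [DecidableEq κ] [IsTopologicalRing K] (T : Matrix κ κ K)
    (y : κ → K) :
    Continuous fun u : κ → K => Matrix.toLinearMap₂' K T u y := by
  simp only [Matrix.toLinearMap₂'_apply']
  exact continuous_finsetSum _ fun i _ => (continuous_apply i).mul continuous_const

omit [Invertible (2 : K)] in
include hA in
/-- **`ρ_A = ρ_1 ∘ mapEquiv (dualCoords A)`**: the Schrödinger model of the Gram duality `β_A` IS the standard Schrödinger
model read through the dual coordinates (`ρ_A((x,y),t) f (u) = ψ(t + u ⬝ A y) f(u + x) = ρ_1((x, A y), t) f (u)`).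
[cite: MoeglinVignerasWaldspurger1987, Chap. 2 I.4 Exemple (1)] -/
theorem schrodingerSB_gram_eq_mapEquiv (hb₁ : ∀ y : ι → K, Continuous fun u : ι → K => Matrix.toLinearMap₂' K (1 : Matrix ι ι K) u y)
    (a : Heisenberg (polar (Matrix.toLinearMap₂' K A))) :
    schrodingerSB (Matrix.toLinearMap₂' K A) ψ hl hb a =
      schrodingerSB (Matrix.toLinearMap₂' K (1 : Matrix ι ι K)) ψ hl hb₁
        (Heisenberg.mapEquiv (dualCoords A hA) (polar_one_dualCoords A hA) a) := by
  refine LinearMap.ext fun f => Subtype.ext (funext fun u => ?_)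
  rw [schrodingerSB_apply, schrodingerSB_apply, Heisenberg.mapEquiv_t, Heisenberg.mapEquiv_v, dualCoords_apply]
  simp only [Matrix.toLinearMap₂'_apply', Matrix.one_mulVec]

/-- **Weil's relation for the Weyl element of the `ι₁`-block, standard duality in Gram currency**: the Fourier automorphism
`piFourierEquivSB μ₁ hψ hm` of `𝒮(K^{ι₁})` implements `ofSymplectic (weylSpOne ι₁)` for `schrodingerSB (toLinearMap₂' K 1) ψ`
(the tree's `piWeylPair_mem_mpPairs`, stated for `dotProductBilin`, moved along the identity). [cite: Weil1964, n° 13, p. 160] -/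
theorem implements_weylSpOne_piFourier
    (hb₁ : ∀ y : ι₁ → K, Continuous fun u : ι₁ → K => Matrix.toLinearMap₂' K (1 : Matrix ι₁ ι₁ K) u y) :
    Implements (schrodingerSB (Matrix.toLinearMap₂' K (1 : Matrix ι₁ ι₁ K)) ψ hl hb₁)
      (ofSymplectic _ (weylSpOne (K := K) ι₁)) (piFourierEquivSB μ₁ hψ hm) := by
  -- the identity is an isomorphism of Heisenberg data `(polar β_1) ≅ (polar dotProductBilin)`
  have hB : ∀ v w : (ι₁ → K) × (ι₁ → K),
      polar (dotProductBilin K K (m := ι₁)) (LinearEquiv.refl K _ v) (LinearEquiv.refl K _ w) =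
        polar (Matrix.toLinearMap₂' K (1 : Matrix ι₁ ι₁ K)) v w := fun v w => by
    simp only [polar_apply, LinearEquiv.refl_apply, dotProductBilin_apply_apply, Matrix.toLinearMap₂'_apply',
      Matrix.one_mulVec]
  have hρ : ∀ a : Heisenberg (polar (Matrix.toLinearMap₂' K (1 : Matrix ι₁ ι₁ K))),
      schrodingerSB (Matrix.toLinearMap₂' K (1 : Matrix ι₁ ι₁ K)) ψ hl hb₁ a =
        schrodingerSB (dotProductBilin K K) ψ (isLocallyConstant_of_isContinuousNontrivial hψ)
          continuous_dotProductBilin_left (Heisenberg.mapEquiv (LinearEquiv.refl K _) hB a) := fun a => by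
    refine LinearMap.ext fun f => Subtype.ext (funext fun u => ?_)
    rw [schrodingerSB_apply, schrodingerSB_apply, Heisenberg.mapEquiv_t, Heisenberg.mapEquiv_v, LinearEquiv.refl_apply]
    simp only [Matrix.toLinearMap₂'_apply', Matrix.one_mulVec, dotProductBilin_apply_apply]
  refine (implements_iff_implements_symplecticConj (LinearEquiv.refl K _) hB hρ (weylSpOne (K := K) ι₁)
    (piFourierEquivSB μ₁ hψ hm)).2 ?_
  -- the conjugate by the identity is the `dotProductBilin` Weyl element, whose Weil section is `piWeylElt`
  have hW : symplecticConj (LinearEquiv.refl K _) hB (weylSpOne (K := K) ι₁) =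
      weylSp (dotProductBilin K K) (LinearEquiv.refl K (ι₁ → K)) (LinearEquiv.neg K) dotProductBilin_refl_neg :=
    Subtype.ext (LinearEquiv.ext fun w => rfl)
  rw [hW, ofSymplectic_weylSp]
  exact (mem_mpPairs _ _).1 (piWeylPair_mem_mpPairs μ₁ hψ hm)

include hA hψ in
/-- **P5(c): `𝓕_{x'} ⊠ 1` IMPLEMENTS THE PARTIAL WEYL ELEMENT.**  For every Gram matrix `A` with unit determinant, every splitting
`e : ι₁ ⊕ ι₂ ≃ ι`, every Haar measure `μ₁` on `K^{ι₁}`: the operator `boxEquivSB K e (piFourierEquivSB μ₁ hψ hm) 1` (Fourier in the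
`ι₁`-variables, identity in the `ι₂`-variables) satisfies MVW's relation (A) `M ρ_A(h) = ρ_A(s · h) M` for
`s = ofSymplectic (partialWeyl A hA e)` — i.e. `(partialWeyl A hA e, 𝓕_{x'} ⊠ 1) ∈ S̃p_ψ(𝕎)`.
[cite: MoeglinVignerasWaldspurger1987, Chap. 2 II.1 (A), II.6] [cite: Weil1964, n° 13, p. 160] -/
theorem implements_partialWeyl_boxFourier :
    Implements (schrodingerSB (Matrix.toLinearMap₂' K A) ψ hl hb) (ofSymplectic _ (partialWeyl A hA e))
      (boxEquivSB K e (piFourierEquivSB μ₁ hψ hm) (LinearEquiv.refl ℂ (SchwartzBruhat (ι₂ → K)))) := by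
  have hb₁ := continuous_toLinearMap₂'_left' (K := K) (1 : Matrix ι₁ ι₁ K)
  have hb₂ := continuous_toLinearMap₂'_left' (K := K) (1 : Matrix ι₂ ι₂ K)
  have hbι := continuous_toLinearMap₂'_left' (K := K) (1 : Matrix ι ι K)
  -- (1) `𝓕 ⊠ 1` implements `w₁ ⊕ 1` for the standard duality on `K^ι`
  have h1 : Implements (schrodingerSB (Matrix.toLinearMap₂' K (1 : Matrix ι₂ ι₂ K)) ψ hl hb₂)
      (ofSymplectic _ (1 : symplecticGroup (polar (Matrix.toLinearMap₂' K (1 : Matrix ι₂ ι₂ K)))))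
      (LinearEquiv.refl ℂ (SchwartzBruhat (ι₂ → K))) := by
    have h0 : ofSymplectic (polar (Matrix.toLinearMap₂' K (1 : Matrix ι₂ ι₂ K)))
        (1 : symplecticGroup (polar (Matrix.toLinearMap₂' K (1 : Matrix ι₂ ι₂ K)))) = 1 := map_one _
    rw [h0]
    exact implements_one_refl _
  have hbox := implements_of_boxSB e (1 : Matrix ι₁ ι₁ K) (1 : Matrix ι₂ ι₂ K) (one_eq_reindex_fromBlocks_one e) hl hb₁ hb₂ hbι
    (weylSpOne (K := K) ι₁) 1 (implements_weylSpOne_piFourier hψ hm hl μ₁ hb₁) h1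
    (M := boxEquivSB K e (piFourierEquivSB μ₁ hψ hm) (LinearEquiv.refl ℂ (SchwartzBruhat (ι₂ → K))))
    (fun f₁ f₂ => boxEquivSB_boxSB K e _ _ f₁ f₂)
  have h1' : spInl e (1 : Matrix ι₁ ι₁ K) (1 : Matrix ι₂ ι₂ K) (one_eq_reindex_fromBlocks_one e) (weylSpOne (K := K) ι₁) *
      spInr e (1 : Matrix ι₁ ι₁ K) (1 : Matrix ι₂ ι₂ K) (one_eq_reindex_fromBlocks_one e) 1 =
      spInl e (1 : Matrix ι₁ ι₁ K) (1 : Matrix ι₂ ι₂ K) (one_eq_reindex_fromBlocks_one e) (weylSpOne (K := K) ι₁) := by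
    rw [(spInr e (1 : Matrix ι₁ ι₁ K) (1 : Matrix ι₂ ι₂ K) (one_eq_reindex_fromBlocks_one e)).map_one, mul_one]
  rw [h1'] at hbox
  -- (2) transport from `A = 1` to `A` along the dual coordinates
  refine (implements_iff_implements_symplecticConj (dualCoords A hA) (polar_one_dualCoords A hA)
    (schrodingerSB_gram_eq_mapEquiv A hA hl hb hbι) (partialWeyl A hA e) _).2 ?_
  rw [partialWeyl, MulEquiv.apply_symm_apply]
  exact hbox

end Implements

/-! ## §4 Bookkeeping for the consumers -/

section Bookkeeping

variable (K : Type*) [Field K] [ValuativeRel K] [TopologicalSpace K] [IsNonarchimedeanLocalField K]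
  {ι₁ ι₂ ι : Type*} [Fintype ι₁] [Fintype ι₂] [Fintype ι] (e : ι₁ ⊕ ι₂ ≃ ι)

/-- `boxEquivSB` and `sumEndSB` are the same operator (`M₁ ⊠ M₂`), the former bundled as an automorphism.
[cite: MoeglinVignerasWaldspurger1987, Chap. 2 II.1 Rem. (6)] -/
theorem coe_boxEquivSB_eq_sumEndSB (M₁ : SchwartzBruhat (ι₁ → K) ≃ₗ[ℂ] SchwartzBruhat (ι₁ → K))
    (M₂ : SchwartzBruhat (ι₂ → K) ≃ₗ[ℂ] SchwartzBruhat (ι₂ → K)) :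
    (boxEquivSB K e M₁ M₂ : SchwartzBruhat (ι → K) →ₗ[ℂ] SchwartzBruhat (ι → K)) =
      sumEndSB K e (M₁ : SchwartzBruhat (ι₁ → K) →ₗ[ℂ] SchwartzBruhat (ι₁ → K))
        (M₂ : SchwartzBruhat (ι₂ → K) →ₗ[ℂ] SchwartzBruhat (ι₂ → K)) :=
  linearMap_ext_boxSB K e fun f₁ f₂ => by
    rw [LinearEquiv.coe_coe, boxEquivSB_boxSB, sumEndSB_boxSB, LinearEquiv.coe_coe, LinearEquiv.coe_coe]

end Bookkeeping

/-! ## §5 The inverse of the partial Weyl element, and its conjugate of a lower Siegel unipotent (two-unipotent route of P7) -/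

section Conjugation

variable {K : Type*} [Field K] [Invertible (2 : K)] {ι₁ ι₂ ι : Type*} [Fintype ι₁] [Fintype ι₂] [Fintype ι]
  [DecidableEq ι₁] [DecidableEq ι₂] [DecidableEq ι] (A : Matrix ι ι K) (hA : IsUnit A.det) (e : ι₁ ⊕ ι₂ ≃ ι)

omit [Invertible (2 : K)] [Fintype ι₁] [Fintype ι₂] [Fintype ι] [DecidableEq ι₁] [DecidableEq ι₂] [DecidableEq ι] in
/-- glued vectors subtract in the first slot: `(a − a') ⊔ b = a ⊔ b − a' ⊔ 0`. [cite: Kudla1984, §1] -/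
theorem glue_sub_left (a a' : ι₁ → K) (b : ι₂ → K) : glue e (a - a') b = glue e a b - glue e a' 0 := by
  rw [eq_sub_iff_add_eq, glue_add, sub_add_cancel, add_zero]

omit [Invertible (2 : K)] in
/-- **formula for the inverse of the partial Weyl element**: with `η := A y`,
`partialWeyl⁻¹ (x, y) = ((−η|₁) ⊔ x|₂, A⁻¹ (x|₁ ⊔ η|₂))`. [cite: Weil1964, n° 6, p. 151] -/
theorem coe_partialWeyl_inv_apply (w : (ι → K) × (ι → K)) :
    (((partialWeyl A hA e)⁻¹ : symplecticGroup (polar (Matrix.toLinearMap₂' K A))) :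
        ((ι → K) × (ι → K)) ≃ₗ[K] ((ι → K) × (ι → K))) w =
      (glue e (-(resL e (A *ᵥ w.2))) (resR e w.1), A⁻¹ *ᵥ glue e (resL e w.1) (resR e (A *ᵥ w.2))) := by
  rw [Subgroup.coe_inv, LinearEquiv.coe_inv, LinearEquiv.symm_apply_eq, coe_partialWeyl_apply]
  refine Prod.ext ?_ ?_
  · simp only [Matrix.mulVec_mulVec, Matrix.mul_nonsing_inv A hA, Matrix.one_mulVec, resL_glue, resR_glue,
      glue_resL_resR]
  · simp only [Matrix.mulVec_mulVec, Matrix.mul_nonsing_inv A hA, Matrix.one_mulVec, resL_glue, resR_glue, neg_neg,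
      glue_resL_resR, Matrix.nonsing_inv_mul A hA]

/-- **The partial Weyl element conjugates a LOWER Siegel unipotent supported on the `ι₁`-block (in `A`-dual coordinates)
into the UPPER unipotent** `(x, y) ↦ (x − (c₁ η|₁) ⊔ 0, y)`, `η = A y`: for `c : X →ₗ Y` symmetric for `β_A` with
`A (c x) = (c₁ x|₁) ⊔ 0`, `partialWeyl · n(c) · partialWeyl⁻¹ = (x, y) ↦ (x − (c₁ (A y)|₁) ⊔ 0, y)`.  (Two-unipotent route of
the cell's P7: the root subgroup at the hyperbolic partner `r'` is this upper unipotent after the polarisation mover, so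
`𝓕_{x'} ⊠ 1` conjugates its implementers into second-degree characters — `Implements.mul`, `Implements.inv`.)
[cite: Weil1964, n° 6, p. 151] [cite: MoeglinVignerasWaldspurger1987, Chap. 2 II.6] -/
theorem coe_partialWeyl_conj_unipotentSp_apply (c : (ι → K) →ₗ[K] (ι → K))
    (hc : ∀ x x', Matrix.toLinearMap₂' K A x (c x') = Matrix.toLinearMap₂' K A x' (c x))
    (c₁ : (ι₁ → K) →ₗ[K] (ι₁ → K)) (hcc₁ : ∀ x, A *ᵥ c x = glue e (c₁ (resL e x)) 0) (w : (ι → K) × (ι → K)) :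
    ((partialWeyl A hA e * unipotentSp (Matrix.toLinearMap₂' K A) c hc * (partialWeyl A hA e)⁻¹ :
        symplecticGroup (polar (Matrix.toLinearMap₂' K A))) : ((ι → K) × (ι → K)) ≃ₗ[K] ((ι → K) × (ι → K))) w =
      (w.1 - glue e (c₁ (resL e (A *ᵥ w.2))) 0, w.2) := by
  rw [Subgroup.coe_mul, Subgroup.coe_mul, LinearEquiv.mul_apply, LinearEquiv.mul_apply, coe_partialWeyl_inv_apply,
    coe_unipotentSp, unipotentσ_apply, coe_partialWeyl_apply]
  have hη : A *ᵥ (A⁻¹ *ᵥ glue e (resL e w.1) (resR e (A *ᵥ w.2)) +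
      c (glue e (-(resL e (A *ᵥ w.2))) (resR e w.1))) =
      glue e (resL e w.1 - c₁ (resL e (A *ᵥ w.2))) (resR e (A *ᵥ w.2)) := by
    rw [Matrix.mulVec_add, hcc₁, Matrix.mulVec_mulVec, Matrix.mul_nonsing_inv A hA, Matrix.one_mulVec, resL_glue,
      map_neg, glue_add, add_zero, sub_eq_add_neg]
  refine Prod.ext ?_ ?_
  · simp only [hη, resL_glue, resR_glue]
    rw [glue_sub_left, glue_resL_resR]
  · simp only [hη, resL_glue, resR_glue, neg_neg, glue_resL_resR, Matrix.mulVec_mulVec, Matrix.nonsing_inv_mul A hA,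
      Matrix.one_mulVec]

end Conjugation

end Literature.RepresentationTheory.HeisenbergGroup

end
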